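import Summits.ABC.IUTFork.Joshi.DictionaryHarnessBridge
import HarnessLib

/-!
# Block E, test X-07′ — the «Joshi-style (Ind2)» instantiation at the pinned carriers, 0: ℚ-line shells and scalars

Record file (D-0012) of the abc-iut cell, block E «type Joshi's construction, test vs S» (rung LADDER-ABC:A2.E; seat abc-iut-E-t41, slot
T-41 = test row **X-07′** of plan/E/cx/TEST-LEDGER.md; rulings abc-iut-E-plan 2026-08-26T06:50:08Z / 06:55:58Z, design and sign-off criterion
abc-iut-E-cx 06:43:20Z / 06:50:46Z). TAKES NO SIDE on [IUTchIII] Cor. 3.12, on Joshi's claims or on Mochizuki's report on them; NO `Prop` fact.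
Part 0 of the X-07′ files (`TestIsmScalingShells` ⟵ `TestIsmScaling` (the model, typed Thm. 3.11, the setting) ⟵ `TestIsmScalingResults`
(the test theorems)); the model's rationale and the zero-label convention are in the module docstring of `TestIsmScaling`.

THIS FILE. Over c312-7's one-place index `Cor312.Checks.toyIndex` (`l⋆ = 2`): the ONE-PLACE ℚ-LINE SHELLS `lineShells A I` (carrier
`log(𝒟⊢_v) := ℚ`, strip-automorphisms `A`, "Ism" `I`) — the family containing abc-iut-w4-d101's `signShells` (`A = I = signs = {±1}`, the
carriers of the pinned model of record, Cor312IdentifiedNonVacuitySigns) and the JOSHI-STYLE SHELLS `scalShells := lineShells signs univ`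
("Ism" := ALL ℚ-linear automorphisms of the line, K. Joshi, *Construction of Arithmetic Teichmüller Spaces III*, arXiv:2401.13508v4, §8.11.1
p. 91 l. 44–46 «indeterminacy with respect to ℚ_p-linear isomorphisms σ», versus [IUTchII] Ex. 1.8 (iv) / [IUTchIII] Prop. 1.2 (vi) «Ism»;
in the tree `LogShells.ism` is a binder with `one_mem_ism` only, Thm311Sig l.186–191). All these shells have, DEFINITIONALLY, the tensor
packets of `signShells` (ℚ-lines with coordinate `line j vQ`, balls `pBall p j vQ k`, frame `pFrame`, volume `pVol` of
Cor312NaivePadicBalls), so the model of record's packet vocabulary is used BY NAME. PROVED: every ℚ-linear automorphism of a packet is a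
nonzero SCALAR on the line (`exists_scalar` — whence every element of `⟨(Ind1) ∪ (Ind2)⟩`, for any `A`, `I`, acts by scalars); a scalar of
valuation `a` carries `B_k` ONTO `B_{k+a}` (`image_pBall_of_scalar`); the explicit (Ind2)-families `scaleFamily u` («`u_j` on the factor `0`,
`1` on the other factors», E-plan 06:50:08Z (a)) of `scalShells`, among them Joshi's untilt change `untiltFamily` (`p^{1−j²}` at label `j`:
[J-III] Thm. 4.2.2.1 (4) eq. (4.2.2.2) p. 33, `B_{j²} ↦ B_1`) and the dilation `dilateFamily` (`p⁻¹`: `B_k ↦ B_{k−1}`).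
Interface level; no judgement on print; typed ≠ proved ≠ endorsed. [claim: Mochizuki2012, status: disputed] [claim: Joshi2024ATS3, status: disputed]
[cite: ScholzeStix2018, §2.2 pp. 9–10]
-/

noncomputable section

open Set

namespace Summit.ABC.IUTFork.Joshi.IsmScaling

open Thm311 Cor312 Cor312.Checks Cor312.IdentifiedNonVacuity Cor312Vol Cor312Vol.NaiveWitness Cor312Vol.PinnedWitness
  Literature.IUT.LogThetaLattice

/-! ## 1. One-place ℚ-line shells, scalars, and the explicit (Ind2)-families -/

/-- The ONE-PLACE ℚ-LINE SHELLS with strip-automorphisms `A` and "Ism" `I` (both containing the identity): carrier `log(𝒟⊢_v) := ℚ`,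
log-shell the unit ball — the family containing abc-iut-w4-d101's `signShells` (`A = I = signs`, the model of record) and the present
`scalShells` (`I = univ`). Its tensor packets are, definitionally, those of `signShells` (ℚ-lines, coordinate `line j vQ`).
[claim: Mochizuki2012, status: disputed] -/
abbrev lineShells (A I : Set (ℚ ≃ₗ[ℚ] ℚ)) (hA : LinearEquiv.refl ℚ ℚ ∈ A) (hI : LinearEquiv.refl ℚ ℚ ∈ I) :
    LogShells toyIndex where
  carrier := fun _ => ℚ
  shell := fun _ => {x | |x| ≤ 1}
  stripAut := fun _ => A
  ism := fun _ => I
  one_mem_stripAut := fun _ => hA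
  one_mem_ism := fun _ => hI

/-- **The Joshi-style shells**: the pinned carriers with the ONE field `ism` changed to ALL ℚ-linear automorphisms of the line
(«ℚ_p-linear isomorphisms σ», [J-III] §8.11.1 p. 91 l. 44–46), strip-automorphisms the signs as in the model of record.
[claim: Joshi2024ATS3, status: disputed] -/
abbrev scalShells : LogShells toyIndex := lineShells signs Set.univ (Set.mem_insert _ _) (Set.mem_univ _)

variable (p : ℕ)

/-- **Every ℚ-linear automorphism of a packet line is a nonzero SCALAR** on the line coordinate (the packets are ℚ-lines). In particular
every element of `⟨(Ind1) ∪ (Ind2)⟩` — for ANY choice of `stripAut`/`ism` over these carriers — acts on each packet by a scalar. [folklore] -/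
theorem exists_scalar (j : toyIndex.Label) (vQ : toyIndex.VQ) (f : signShells.Packet j vQ ≃ₗ[ℚ] signShells.Packet j vQ) :
    ∃ c : ℚ, c ≠ 0 ∧ ∀ x : signShells.Packet j vQ, line j vQ (f x) = c * line j vQ x := by
  refine ⟨line j vQ (f ((line j vQ).symm 1)), ?_, fun x => ?_⟩
  · intro h0
    have h1 : f ((line j vQ).symm 1) = 0 := by
      have := congrArg (line j vQ).symm h0
      rwa [LinearEquiv.symm_apply_apply, map_zero] at this
    have h2 : (line j vQ).symm 1 = 0 := f.injective (by rw [h1, map_zero])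
    have h3 := congrArg (line j vQ) h2
    rw [LinearEquiv.apply_symm_apply, map_zero] at h3
    exact one_ne_zero h3
  · have hx : x = (line j vQ x) • (line j vQ).symm 1 := by
      rw [← map_smul, smul_eq_mul, mul_one, LinearEquiv.symm_apply_apply]
    conv_lhs => rw [hx, map_smul, map_smul, smul_eq_mul]
    exact mul_comm _ _

/-- Multiplication by `c ≠ 0` shifts `p`-adic valuations by `v_p(c)` and preserves vanishing. [folklore] -/
theorem scalar_mem_pBall_iff [hp : Fact p.Prime] {c : ℚ} (hc : c ≠ 0) (k : ℤ) (t : ℚ) :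
    (c * t = 0 ∨ k + padicValRat p c ≤ padicValRat p (c * t)) ↔ (t = 0 ∨ k ≤ padicValRat p t) := by
  by_cases ht : t = 0
  · subst ht; simp
  · rw [padicValRat.mul hc ht]
    constructor
    · rintro (h | h)
      · exact absurd h (mul_ne_zero hc ht)
      · exact Or.inr (by linarith)
    · rintro (h | h)
      · exact absurd h ht
      · exact Or.inr (by linarith)

/-- **A scalar of valuation `a` carries the ball `B_k` ONTO `B_{k+a}`** — the valuation-rescaling that the signs of the model of record
never perform (`image_pBall_of_actsBySigns`: `a = 0`). [folklore] -/
theorem image_pBall_of_scalar [hp : Fact p.Prime] {j : toyIndex.Label} {vQ : toyIndex.VQ}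
    {Φ : signShells.Packet j vQ ≃ₗ[ℚ] signShells.Packet j vQ} {c : ℚ} (hc : c ≠ 0)
    (h : ∀ x, line j vQ (Φ x) = c * line j vQ x) (k : ℤ) :
    Φ '' pBall p j vQ k = pBall p j vQ (k + padicValRat p c) := by
  apply Set.Subset.antisymm
  · rintro _ ⟨x, hx, rfl⟩
    show line j vQ (Φ x) = 0 ∨ k + padicValRat p c ≤ padicValRat p (line j vQ (Φ x))
    rw [h, scalar_mem_pBall_iff p hc]
    exact hx
  · intro y hy
    refine ⟨Φ.symm y, ?_, LinearEquiv.apply_symm_apply _ _⟩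
    have h1 := h (Φ.symm y)
    rw [LinearEquiv.apply_symm_apply] at h1
    show line j vQ (Φ.symm y) = 0 ∨ k ≤ padicValRat p (line j vQ (Φ.symm y))
    rw [← scalar_mem_pBall_iff p hc k, ← h1]
    exact hy

/-- The per-factor units «`u` on the factor `0`, `1` on the other factors» of the `(j+1)`-capsule. [folklore] -/
def factorUnits (j : toyIndex.Label) (u : ℚˣ) : toyIndex.Caps j → ℚˣ := Fin.cons u fun _ => 1

/-- Their product is `u`. [folklore] -/
theorem prod_factorUnits (j : toyIndex.Label) (u : ℚˣ) : (∏ i, (factorUnits j u i : ℚ)) = u := by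
  unfold factorUnits
  rw [Fin.prod_univ_succ]
  simp

/-- **The explicit (Ind2)-family `scaleFamily u`**: at the label `j`, the element `x ↦ u_j·x` of Ism `= univ` on (every summand of) the
tensor factor `0` and the identity on the other `j` factors (E-plan 06:50:08Z (a): «exponent on one factor and 0 on the others»; Thm. 3.11
(i) (Ind2) lets the Ism-element vary independently over factors and summands, Thm311Sig l.278–289). [claim: Joshi2024ATS3, status: disputed] -/
def scaleFamily (u : toyIndex.Label → ℚˣ) : scalShells.PacketAut := fun j vQ =>
  scalShells.factorwise j vQ fun i => scalShells.summandwise vQ fun _ => LinearEquiv.smulOfUnit (factorUnits j (u j) i)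

/-- `scaleFamily u` IS an (Ind2)-family of the Joshi-style shells (every scaling is in Ism `= univ`). [folklore] -/
theorem scaleFamily_mem_Ind2Family (u : toyIndex.Label → ℚˣ) : scaleFamily u ∈ scalShells.Ind2Family := fun j _ =>
  ⟨fun i _ => LinearEquiv.smulOfUnit (factorUnits j (u j) i), fun _ _ => Set.mem_univ _, rfl⟩

/-- … hence lies in the indeterminacy subgroup `⟨(Ind1) ∪ (Ind2)⟩`. [folklore] -/
theorem scaleFamily_mem_closure (u : toyIndex.Label → ℚˣ) :
    scaleFamily u ∈ Subgroup.closure (scalShells.Ind1Family ∪ scalShells.Ind2Family) :=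
  Subgroup.subset_closure (Set.mem_union_right _ (scaleFamily_mem_Ind2Family u))

/-- `scaleFamily u` acts on the label-`j` packet line as multiplication by `u_j`. [folklore] -/
theorem line_scaleFamily (u : toyIndex.Label → ℚˣ) (j : toyIndex.Label) (vQ : toyIndex.VQ) (x : scalShells.Packet j vQ) :
    line j vQ (scaleFamily u j vQ x) = (u j : ℚ) * line j vQ x := by
  have h := line_factorwise_of_smul j vQ
    (fun i => scalShells.summandwise vQ fun _ => LinearEquiv.smulOfUnit (factorUnits j (u j) i))
    (fun i => (factorUnits j (u j) i : ℚ)) (fun i y => by funext v; rfl) x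
  rw [prod_factorUnits] at h
  exact h

/-- `scaleFamily u` carries `B_k` onto `B_{k + v_p(u_j)}` at the label `j`. [folklore] -/
theorem image_pBall_scaleFamily [hp : Fact p.Prime] (u : toyIndex.Label → ℚˣ) (j : toyIndex.Label) (vQ : toyIndex.VQ) (k : ℤ) :
    scaleFamily u j vQ '' pBall p j vQ k = pBall p j vQ (k + padicValRat p (u j : ℚ)) :=
  image_pBall_of_scalar p (u j).ne_zero (line_scaleFamily u j vQ) k

/-- The unit `p^a ∈ ℚˣ`. [folklore] -/
def ppowUnit [hp : Fact p.Prime] (a : ℤ) : ℚˣ := Units.mk0 ((p : ℚ) ^ a) (ppow_ne_zero p a)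

/-- **Joshi's untilt change `y′_{w,1} ↦ y′_{w,j}` as an (Ind2)-family** ([J-III] Thm. 4.2.2.1 (4) eq. (4.2.2.2), p. 33; read by §8.11.1
p. 91 l. 27–46 as Mochizuki's (Ind2)): at the label `j` the scaling by `p^{1−j²}` on the factor `0` — the move carrying the Θ-region
`B_{j²} = q^{j²}·𝒪` onto the q-region `B_1 = q·𝒪` (abc-iut-w5-d155's «honest transport `x ↦ q^{1−j²}·x`», Cor312PinnedRegionsLinkNaive,
which is NOT an indeterminacy of the model of record and IS one here). [claim: Joshi2024ATS3, status: disputed] -/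
def untiltFamily [hp : Fact p.Prime] : scalShells.PacketAut := scaleFamily fun j => ppowUnit p (1 - jsq j)

/-- The DILATION family `x ↦ p⁻¹·x` on the factor `0` at every label (valuation `−1` on every packet line). [claim: Joshi2024ATS3, status: disputed] -/
def dilateFamily [hp : Fact p.Prime] : scalShells.PacketAut := scaleFamily fun _ => ppowUnit p (-1)

/-- `untiltFamily` carries `B_k` onto `B_{k+1−j²}` at the label `j`. [folklore] -/
theorem image_pBall_untiltFamily [hp : Fact p.Prime] (j : toyIndex.Label) (vQ : toyIndex.VQ) (k : ℤ) :
    untiltFamily p j vQ '' pBall p j vQ k = pBall p j vQ (k + (1 - jsq j)) := by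
  unfold untiltFamily
  rw [image_pBall_scaleFamily]
  show pBall p j vQ (k + padicValRat p ((p : ℚ) ^ (1 - jsq j))) = _
  rw [padicValRat_ppow]

/-- `dilateFamily` carries `B_k` onto `B_{k−1}` (a STRICTLY LARGER ball, of log-volume larger by `log p`). [folklore] -/
theorem image_pBall_dilateFamily [hp : Fact p.Prime] (j : toyIndex.Label) (vQ : toyIndex.VQ) (k : ℤ) :
    dilateFamily p j vQ '' pBall p j vQ k = pBall p j vQ (k - 1) := by
  unfold dilateFamily
  rw [image_pBall_scaleFamily]
  show pBall p j vQ (k + padicValRat p ((p : ℚ) ^ (-1 : ℤ))) = _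
  rw [padicValRat_ppow, sub_eq_add_neg]

end Summit.ABC.IUTFork.Joshi.IsmScaling

end
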